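import Literature.AlgebraicGeometry.Limits.StageRestriction   -- ★ `resIso`, `whiskerLeft_leg_comp_res`, `ext_of_whiskerLeft_leg_comp_eq`
import HarnessLib

/-!
# Limits of schemes: a finite group of automorphisms of the generic fibre spreads, AS A GROUP ACTION, to some stage `Spec A[1∕t]`
# ([EGAIV3] 8.8.2 (i), 8.8.2.5; [GortzWedhorn2020] Thm. 10.63 ∕ Cor. 10.64)

Topic `Literature/AlgebraicGeometry/Limits`; namespace `Literature.AlgebraicGeometry.Limits.LocApprox`.  THEOREMS ONLY (no definition, no
named fact, no instance, no notation, no `sorry`).  Cell `hodgecm-mathlib`, P6 «MOD programme», P6a ED.-2 census 8396c07d §3∕§4 hand EQV-SPREAD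
(`stub_EQV : EquivariantSpreadCofinite`), STAGE FORM (file 1 of 2; file 2 passes from the stage to `𝒪_{F,(w)}` for cofinitely many `w` and to
★ `IntegralModel.localise`).  HC_CM is proved only modulo the printed citations until rung 0 closes; nothing here is about HC.

THE MATHEMATICS.  `A` a domain with fraction field `K`, `P → Spec A` quasi-compact, quasi-separated, locally of finite presentation, FLAT and
SEPARATED; `H` a finite group acting on the generic fibre `P ⊗_A K` by `K`-automorphisms.  Each `ρ(h)` spreads to an automorphism of
`P ⊗_A A[1∕t_h]` over `Spec A[1∕t_h]` inducing `ρ(h)` on `P ⊗_A K` (★ `exists_iso_whiskerLeft_leg_comp_eq`, [GortzWedhorn2020] Cor. 10.64 (2));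
restrict all of them to a common stage `t = ∏ t_h` (★ `resIso`, `whiskerLeft_leg_comp_res`); the group law `σ(1) = 1`, `σ(hh′) = σ(h′) ≫ σ(h)`
holds because both sides are morphisms over `Spec A[1∕t]` from the FLAT `P ⊗ A[1∕t]` to the SEPARATED `P ⊗ A[1∕t]` agreeing on the schematically
dense generic fibre (★ `ext_of_whiskerLeft_leg_comp_eq`, [EGAIV3] 11.10.5 ∕ [GortzWedhorn2020] Thm. 10.63 faithfulness).  Hence `ρ` spreads to a
group homomorphism `σ : H →* Aut (P ⊗ Spec A[1∕t])` by automorphisms over the stage, inducing `ρ` on the generic fibre.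

MAIN STATEMENTS.  `exists_hom_forall` (a finite family of stages has a common refinement) · **`exists_monoidHom_aut_stage`** (the theorem above).

## References
* [EGAIV3] A. Grothendieck, *EGA* IV₃, Publ. Math. IHÉS 28 (1966), Thm. 8.8.2 (i), 8.8.2.5, Prop. 11.10.5.
* [GortzWedhorn2020] U. Görtz, T. Wedhorn, *Algebraic Geometry I* (2nd ed.), Thm. 10.63 and Cor. 10.64 (pp. 328–329).
-/

noncomputable section

universe u

open CategoryTheory CategoryTheory.Limits AlgebraicGeometry MonoidalCategory CartesianMonoidalCategory

-- Mathlib's pull-back ∕ cartesian-monoidal API is stated through `abbrev`s (as in the tree's `Limits/*` files).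
set_option backward.isDefEq.respectTransparency false

namespace Literature.AlgebraicGeometry.Limits

namespace LocApprox

open Literature.AlgebraicGeometry.Motives (SchemeOver specOver)

/-! ## §1 A finite family of stages has a common refinement -/

section CommonStage

variable {A : Type u} [CommRing A] {S : Submonoid A}

/-- **A finite family of stages `D(t_i)` has a common refinement** `D(t) → D(t_i)` (`t = ∏ t_i`; the index preorder is `t ≤ s ↔ s ∣ t`).
[cite: GortzWedhorn2020, Thm. 10.63] -/
theorem exists_hom_forall {ι : Type*} [Finite ι] (s : ι → Idx S) : ∃ t : Idx S, ∀ i, Nonempty (t ⟶ s i) := by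
  classical
  haveI := Fintype.ofFinite ι
  refine ⟨⟨∏ i, (s i).val, Submonoid.prod_mem S fun i _ => (s i).mem⟩, fun i => ⟨homOfLE ?_⟩⟩
  exact Finset.dvd_prod_of_mem (fun i => (s i).val) (Finset.mem_univ i)

end CommonStage

/-! ## §2 Spreading a finite group of generic automorphisms to a stage -/

section ActionStage

variable {A : Type u} [CommRing A] [IsDomain A] (K : Type u) [Field K] [Algebra A K] [IsFractionRing A K]
  (P : SchemeOver A) [QuasiCompact P.hom] [QuasiSeparated P.hom] [LocallyOfFinitePresentation P.hom]
  [Flat P.hom] [IsSeparated P.hom]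
  {H : Type*} [Group H] [Finite H]

/-- **A finite group of automorphisms of the generic fibre spreads to a group action over some stage `Spec A[1∕t]`** ([EGAIV3] 8.8.2 (i),
8.8.2.5; [GortzWedhorn2020] Thm. 10.63 ∕ Cor. 10.64): for `P → Spec A` quasi-compact, quasi-separated, locally of finite presentation, flat and
separated over the domain `A` (`K = Frac A`) and `ρ : H →* Aut (P ⊗ Spec K)` acting by automorphisms OVER `Spec K`, there are a stage `t` and
`σ : H →* Aut (P ⊗ Spec A[1∕t])` acting by automorphisms over `Spec A[1∕t]` such that `(P ◁ π_t) ≫ σ(h) = ρ(h) ≫ (P ◁ π_t)` for every `h`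
(`π_t : Spec K → Spec A[1∕t]` the leg of the localisation cone). [cite: GortzWedhorn2020, Cor. 10.64 (2), p. 329] [cite: EGAIV3, Thm. 8.8.2 (i) and 8.8.2.5] -/
theorem exists_monoidHom_aut_stage (ρ : H →* Aut (P ⊗ specOver A K))
    (hρ : ∀ h : H, (ρ h).hom ≫ snd _ _ = snd _ _) :
    ∃ (t : Idx (nonZeroDivisors A)) (σ : H →* Aut (P ⊗ (baseDiagram (nonZeroDivisors A)).obj t)),
      (∀ h : H, (σ h).hom ≫ snd _ _ = snd _ _) ∧
        ∀ h : H, (P ◁ leg (nonZeroDivisors A) K t) ≫ (σ h).hom = (ρ h).hom ≫ (P ◁ leg (nonZeroDivisors A) K t) := by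
  classical
  -- spread each `ρ h` to an isomorphism over its own stage
  have H1 : ∀ h : H, ∃ (t : Idx (nonZeroDivisors A))
      (e : P ⊗ (baseDiagram (nonZeroDivisors A)).obj t ≅ P ⊗ (baseDiagram (nonZeroDivisors A)).obj t),
        e.hom ≫ snd _ _ = snd _ _ ∧
          (P ◁ leg (nonZeroDivisors A) K t) ≫ e.hom = (ρ h).hom ≫ (P ◁ leg (nonZeroDivisors A) K t) :=
    fun h => exists_iso_whiskerLeft_leg_comp_eq (nonZeroDivisors A) K (ρ h) (hρ h)
  choose th e he hc using H1
  -- a common refinement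
  obtain ⟨t, ht⟩ := exists_hom_forall th
  have f : ∀ h : H, t ⟶ th h := fun h => (ht h).some
  -- the restricted isomorphisms at the common stage
  let E : H → (P ⊗ (baseDiagram (nonZeroDivisors A)).obj t ≅ P ⊗ (baseDiagram (nonZeroDivisors A)).obj t) :=
    fun h => resIso (f h) (e h) (he h)
  have hE : ∀ h, (E h).hom ≫ snd _ _ = snd _ _ := fun h => by
    change res (f h) (e h).hom ≫ snd _ _ = snd _ _
    exact res_snd (f h) (e h).hom
  have hcE : ∀ h, (P ◁ leg (nonZeroDivisors A) K t) ≫ (E h).hom = (ρ h).hom ≫ (P ◁ leg (nonZeroDivisors A) K t) :=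
    fun h => whiskerLeft_leg_comp_res (f h) K (e h).hom (he h) (ρ h).hom (hc h)
  -- composites over the stage are over the stage
  have hcomp : ∀ a b : H, ((E b).hom ≫ (E a).hom) ≫ snd _ _ = snd _ _ := fun a b => by
    rw [Category.assoc, hE a, hE b]
  -- the group law holds on the generic fibre, hence over the stage (flat source, separated target)
  have hone : (E 1).hom = 𝟙 _ := by
    refine ext_of_whiskerLeft_leg_comp_eq K _ _ (hE 1) (Category.id_comp _) ?_
    rw [hcE 1, map_one, Category.comp_id]
    rfl
  have hmul : ∀ a b : H, (E (a * b)).hom = (E b).hom ≫ (E a).hom := fun a b => by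
    refine ext_of_whiskerLeft_leg_comp_eq K _ _ (hE (a * b)) (hcomp a b) ?_
    rw [hcE (a * b), map_mul, ← Category.assoc, hcE b, Category.assoc, hcE a, ← Category.assoc]
    rfl
  -- package as a monoid homomorphism into `Aut`
  refine ⟨t, { toFun := E, map_one' := Iso.ext hone, map_mul' := fun a b => Iso.ext (hmul a b) }, hE, hcE⟩

end ActionStage

end LocApprox

end Literature.AlgebraicGeometry.Limits
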